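import Summits.QuantumAdvantage.QuantumAdvantage.Theorems.AnchorDialLaw

/-!
# AnchorDial — part 12/13 «Generic» (cell decomp-qadv, seat lens-2, generation 14 rev 7; supports item 26531 `ExactnessDial.PolyLossOddU3`)

§12e–§12f of the node (rev 7).  §12e `devA` (every strategy carries its own deviation indicators `A_k := [P_k = 1] ⊕ t_k`,
`devA_apply_eq_one : A_k(x) = 1 ↔ k ∈ dev P x`, `anc_devA`).  §12f the class conditions `UniDev`, `StabDev`;
**`uniDev_loss_degfree`** — the uni-deviation flip-stable class is LEVEL 0: `UniDev P ∧ StabDev P ⟹ 2^{n-1} ≤ 5·#losers`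
for EVERY strategy, NO degree hypothesis, `n ≥ 16` (frozen law part 3 + averaging; rev 6's degree-`(log₂ n)^c` lemma
`uniDev_loss` was dominated by it and is not landed); **`MultiDevLoss3`** (= `T` restricted to `¬(UniDev ∧ StabDev)`),
`multiDevLoss3_of_polyLossOddU3`, `loss_shape_mono`, **`polyLossOddU3_of_multiDevLoss3`** (dichotomy, degree-free special
class), **`polyLossOddU3_iff_multiDevLoss3`**, `ptrLocLift3_iff_multiDevLoss3`, **`closes_generic : MultiDevLoss3 → DPLift3 →
AdviceFreeQNC0Three`**, `not_uniDev_canonical` (non-vacuity).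
Declarations verbatim from the node file `HOME/decomp-qadv-lens-2/g14/AnchorDial.lean` (rev 7); namespace
`Summit.QuantumAdvantage.QuantumAdvantage.Theorems.AnchorDial`.  Imports part 11.  Joint check `tree/Chain13.check.lean`.  Record: NODE-g14.md §REV 7.
Prop defs (`UniDev`, `StabDev`, `MultiDevLoss3`) are statements of the node: `MultiDevLoss3` is a typed normal form of 26531 (≡ T), not a new crux.
-/

set_option linter.dupNamespace false
set_option linter.unusedVariables false

noncomputable section

open scoped Classical

namespace Summit.QuantumAdvantage.QuantumAdvantage.Theorems.AnchorDial

open Finset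
open Literature.Computability.QuantumComplexity Literature.Computability.QuantumComplexity.RingHLF
open Literature.Computability.MetaComplexity Literature.Computability.MetaComplexity.Smolensky
open Summit.QuantumAdvantage.AdviceFreeQNC0
open Summit.QuantumAdvantage.QuantumAdvantage.Theses (ExactnessDial.PolyLossOddU3 ExactnessDial.DPLift3)
open Summit.QuantumAdvantage.QuantumAdvantage.Theorems.HolonomyDial (gCond tPoly tPoly_mem tPoly_apply selP selP_mem
  selP_apply xorP xorP_mem xorP_apply_bool closes_T)

variable {N : ℕ}

section UniDev

/-- the deviation-set indicator family of a strategy: `A_k := [P_k = 1] ⊕ t_k`, so that `A_k(x) = 1 ↔ k ∈ dev P x`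
(degree `2·deg P + 2`): every strategy carries its own anchor indicators; used as the SELECTOR in §12g and as the
anchor family in `anchorable_of_uniDev_stabDev`.  (rev 7: the rev-6 lemma `uniDev_loss` — degree `(log₂ n)^c`,
constant `1/48` — is REMOVED as dominated by the degree-free `uniDev_loss_degfree` below.) -/
def devA (P : Fin N → CubeFn (ZMod 3) N) (k : Fin N) : CubeFn (ZMod 3) N := xorP (selP (P k)) (tPoly k)

/-- AnchorDialGeneric helper `devA_mem` (decomp-qadv land package; see the module docstring). -/
theorem devA_mem {D : ℕ} {P : Fin N → CubeFn (ZMod 3) N} (hP : ∀ i, P i ∈ lowDeg (ZMod 3) N D) (k : Fin N) :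
    devA P k ∈ lowDeg (ZMod 3) N ((D + D) + 2) := xorP_mem (selP_mem (hP k)) (tPoly_mem k)

/-- AnchorDialGeneric helper `devA_apply_eq_one` (decomp-qadv land package; see the module docstring). -/
theorem devA_apply_eq_one (P : Fin N → CubeFn (ZMod 3) N) (k : Fin N) (x : Fin N → Bool) :
    devA P k x = 1 ↔ k ∈ dev P x := by
  have hs : selP (P k) x = if decide (P k x = 1) then 1 else 0 := by
    rw [selP_apply]; by_cases hq : P k x = 1 <;> simp [hq]
  have h := xorP_apply_bool (selP (P k)) (tPoly k) x (decide (P k x = 1)) (tGuess x k) hs (tPoly_apply k x)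
  rw [devA, h, dev, mem_filter]
  simp only [mem_univ, true_and]
  generalize decide (P k x = 1) = p
  generalize tGuess x k = q
  cases p <;> cases q <;> decide

/-- AnchorDialGeneric helper `anc_devA` (decomp-qadv land package; see the module docstring). -/
theorem anc_devA (P : Fin N → CubeFn (ZMod 3) N) (x : Fin N → Bool) :
    (univ.filter fun k' : Fin N => devA P k' x = 1) = dev P x := by
  ext k; rw [mem_filter, devA_apply_eq_one]; simp

end UniDev

section Generic

/-- UNIQ — the deviation set of the strategy is a single position on all but `2^{-12}` of the odd class. -/
def UniDev (P : Fin N → CubeFn (ZMod 3) N) : Prop :=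
  4096 * (univ.filter fun x : Fin N → Bool => OddZeros x ∧ (dev P x).card ≠ 1).card ≤ 2 ^ (N - 1)

/-- STAB — under an average adjacent pair-flip the deviation set changes on at most `2^{-12}` of the odd class. -/
def StabDev (P : Fin N → CubeFn (ZMod 3) N) : Prop :=
  4096 * (∑ a ∈ range N, (univ.filter fun x : Fin N → Bool =>
    OddZeros x ∧ dev P (flip2 a (a + 1) x) ≠ dev P x).card) ≤ N * 2 ^ (N - 1)

section DegreeFree

/-- **THE UNI-DEVIATION FLIP-STABLE CLASS IS LEVEL 0 — degree-free.**  A strategy whose deviation set is a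
single point on all but `2^{-12}` of the odd class (`UniDev`) and flip-stable on average (`StabDev`) loses on at
least a FIFTH of the odd class — EVERY strategy, NO degree hypothesis, every `n ≥ 16`: pick the two flip positions
minimising the instability profile on `[0, n/4)` and `[n/4+1, n/2]`, the deviation point is then frozen on
`≥ 1 - 1/128` of the odd class, a single point lies in one gap, and the frozen law §3 (`frozen_loss_count`) loses a
quarter.  (rev 7; this is why no degree-`(log₂ n)^c` version is stated — rev 6's `uniDev_loss`, constant `1/48`, was
dominated by it.  The polylog-degree content of the dial begins at the ±1 selector jitter, `anchoredDev_loss` §12g.) -/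
theorem uniDev_loss_degfree (hN : 16 ≤ N) (P : Fin N → CubeFn (ZMod 3) N) (hU : UniDev P) (hS : StabDev P) :
    2 ^ (N - 1) ≤ 5 * (univ.filter fun x : Fin N → Bool =>
      OddZeros x ∧ ¬ Rel x (fun i => decide (P i x = 1))).card := by
  set U : ℕ → ℕ := fun a => (univ.filter fun x : Fin N → Bool =>
    OddZeros x ∧ dev P (flip2 a (a + 1) x) ≠ dev P x).card with hUdef
  have hS' : 4096 * ∑ a ∈ range N, U a ≤ N * 2 ^ (N - 1) := hS
  have hU' : 4096 * (univ.filter fun x : Fin N → Bool => OddZeros x ∧ (dev P x).card ≠ 1).card ≤ 2 ^ (N - 1) :=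
    hU
  set L := N / 4 with hL
  have hL4 : 4 ≤ L := by omega
  have hL8 : N ≤ 8 * L := by omega
  have h2L : 2 * L + 4 ≤ N := by omega
  obtain ⟨a₁, ha₁m, ha₁⟩ := exists_min_image (range L) U ⟨0, mem_range.2 (by omega)⟩
  obtain ⟨a₂, ha₂m, ha₂⟩ :=
    exists_min_image (Finset.Ico (L + 1) (2 * L + 1)) U ⟨L + 1, by rw [Finset.mem_Ico]; omega⟩
  rw [mem_range] at ha₁m
  rw [Finset.mem_Ico] at ha₂m
  have hsum₁ : L * U a₁ ≤ ∑ a ∈ range N, U a := by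
    have h1 : (range L).card • U a₁ ≤ ∑ a ∈ range L, U a :=
      Finset.card_nsmul_le_sum _ _ _ (fun a ha => ha₁ a ha)
    rw [card_range, smul_eq_mul] at h1
    exact le_trans h1 (Finset.sum_le_sum_of_subset_of_nonneg
      (fun a ha => by rw [mem_range] at ha ⊢; omega) (fun _ _ _ => Nat.zero_le _))
  have hsum₂ : L * U a₂ ≤ ∑ a ∈ range N, U a := by
    have h1 : (Finset.Ico (L + 1) (2 * L + 1)).card • U a₂ ≤ ∑ a ∈ Finset.Ico (L + 1) (2 * L + 1), U a :=
      Finset.card_nsmul_le_sum _ _ _ (fun a ha => ha₂ a ha)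
    rw [Nat.card_Ico, show 2 * L + 1 - (L + 1) = L by omega, smul_eq_mul] at h1
    exact le_trans h1 (Finset.sum_le_sum_of_subset_of_nonneg
      (fun a ha => by rw [Finset.mem_Ico] at ha; rw [mem_range]; omega) (fun _ _ _ => Nat.zero_le _))
  have hcancel : ∀ u : ℕ, L * u ≤ ∑ a ∈ range N, U a → 512 * u ≤ 2 ^ (N - 1) := by
    intro u hu
    have h1 : 4096 * (L * u) ≤ N * 2 ^ (N - 1) := le_trans (Nat.mul_le_mul_left 4096 hu) hS'
    have h2 : N * 2 ^ (N - 1) ≤ 8 * L * 2 ^ (N - 1) := Nat.mul_le_mul_right _ hL8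
    have h3 : L * (4096 * u) ≤ L * (8 * 2 ^ (N - 1)) := by
      have h := le_trans h1 h2
      rw [show 4096 * (L * u) = L * (4096 * u) by ring,
        show 8 * L * 2 ^ (N - 1) = L * (8 * 2 ^ (N - 1)) by ring] at h
      exact h
    have h4 := Nat.le_of_mul_le_mul_left h3 (by omega)
    omega
  have hU₁ := hcancel (U a₁) hsum₁
  have hU₂ := hcancel (U a₂) hsum₂
  have h12 : a₁ + 2 ≤ a₂ := by omega
  have h2N : a₂ + 3 ≤ N := by omega
  set SF := univ.filter fun x : Fin N → Bool => OddZeros x ∧ Frozen P a₁ a₂ x ∧ OneGap P a₁ a₂ x with hSF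
  set SL := univ.filter fun x : Fin N → Bool => OddZeros x ∧ ¬ Rel x (fun i => decide (P i x = 1)) with hSL
  set A₁ := univ.filter fun x : Fin N → Bool => OddZeros x ∧ dev P (flip2 a₁ (a₁ + 1) x) ≠ dev P x with hA₁
  set A₂ := univ.filter fun x : Fin N → Bool => OddZeros x ∧ dev P (flip2 a₂ (a₂ + 1) x) ≠ dev P x with hA₂
  set B := univ.filter fun x : Fin N → Bool => OddZeros x ∧
    dev P (flip2 a₁ (a₁ + 1) (flip2 a₂ (a₂ + 1) x)) ≠ dev P (flip2 a₂ (a₂ + 1) x) with hB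
  set D := univ.filter fun x : Fin N → Bool => OddZeros x ∧ (dev P x).card ≠ 1 with hD
  have hfro : SF.card ≤ 4 * SL.card := frozen_loss_count (by omega) h12 h2N P
  have hBc : B.card = U a₁ :=
    card_filter_flip2 (a := a₂) (b := a₂ + 1) (by omega) (by omega)
      (fun y => dev P (flip2 a₁ (a₁ + 1) y) ≠ dev P y)
  have hA₁c : A₁.card = U a₁ := rfl
  have hA₂c : A₂.card = U a₂ := rfl
  have hcov : (univ.filter fun x : Fin N → Bool => OddZeros x) ⊆ (((SF ∪ A₁) ∪ A₂) ∪ B) ∪ D := by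
    intro x hx
    rw [mem_filter] at hx
    obtain ⟨-, hodd⟩ := hx
    simp only [hSF, hA₁, hA₂, hB, hD, mem_union, mem_filter, mem_univ, true_and]
    by_cases hD1 : (dev P x).card = 1
    swap
    · exact Or.inr ⟨hodd, hD1⟩
    by_cases hE1 : dev P (flip2 a₁ (a₁ + 1) x) = dev P x
    swap
    · exact Or.inl (Or.inl (Or.inl (Or.inr ⟨hodd, hE1⟩)))
    by_cases hE2 : dev P (flip2 a₂ (a₂ + 1) x) = dev P x
    swap
    · exact Or.inl (Or.inl (Or.inr ⟨hodd, hE2⟩))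
    by_cases hE3 : dev P (flip2 a₁ (a₁ + 1) (flip2 a₂ (a₂ + 1) x)) = dev P (flip2 a₂ (a₂ + 1) x)
    swap
    · exact Or.inl (Or.inr ⟨hodd, hE3⟩)
    refine Or.inl (Or.inl (Or.inl (Or.inl ⟨hodd, ⟨hE1, hE2, hE3.trans hE2⟩, ?_⟩)))
    obtain ⟨p, hp⟩ := card_eq_one.1 hD1
    simp only [OneGap, hp, mem_singleton, forall_eq]
    omega
  have hO := card_odd_ge (N := N) (by omega)
  have hc := card_le_card hcov
  have u1 := card_union_le (((SF ∪ A₁) ∪ A₂) ∪ B) D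
  have u2 := card_union_le ((SF ∪ A₁) ∪ A₂) B
  have u3 := card_union_le (SF ∪ A₁) A₂
  have u4 := card_union_le SF A₁
  omega

end DegreeFree

/-- **PIECE (typed residual) `MultiDevLoss3` — `T` RESTRICTED TO THE GENERIC CLASS.**  The target's own
quantifier (`∀ P` of degree `(log₂ n)^c`, wins counted by `Rel`), restricted to strategies that are NOT
(uni-deviation ∧ flip-stable): multi-point (or empty-on-a-set) deviation sets, or a single deviation point that
jumps under more than an average `2^{-12}` of the adjacent pair-flips.  By the DEGREE-FREE law `uniDev_loss_degfree`
the special class is settled, so `T ⟺ MultiDevLoss3` (`polyLossOddU3_iff_multiDevLoss3`, PROVED both ways): this is what is left of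
`T`, typed as a class restriction.  `≡ T`; IDEA-NEEDED; BARRIER-ADJACENT (small-set Smolensky for moving
multi-pointers; total pair-flip influence `≥ n/4096` for the unstable branch). -/
def MultiDevLoss3 : Prop :=
  ∃ C : ℕ, ∀ c : ℕ, ∃ n₀ : ℕ, ∀ n ≥ n₀, ∀ P : Fin n → CubeFn (ZMod 3) n,
    (∀ i, P i ∈ lowDeg (ZMod 3) n ((Nat.log 2 n) ^ c)) → ¬ (UniDev P ∧ StabDev P) →
      ((univ.filter fun x : Fin n → Bool => OddZeros x ∧ Rel x (fun i => decide (P i x = 1))).card : ℝ) ≤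
        (1 - 1 / (n : ℝ) ^ C) * (2 : ℝ) ^ (n - 1)

/-- restriction: `T → MultiDevLoss3`. -/
theorem multiDevLoss3_of_polyLossOddU3 (h : ExactnessDial.PolyLossOddU3) : MultiDevLoss3 := by
  obtain ⟨C, hC⟩ := h
  refine ⟨C, fun c => ?_⟩
  obtain ⟨n₀, hn₀⟩ := hC c
  exact ⟨n₀, fun n hn P hP _ => hn₀ n hn P hP⟩

/-- monotonicity of the loss shape in the exponent. -/
theorem loss_shape_mono {n : ℕ} (hn : 1 ≤ n) {e e' : ℕ} (he : e ≤ e') (W P : ℝ) (hP : 0 ≤ P)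
    (h : W ≤ (1 - 1 / (n : ℝ) ^ e) * P) : W ≤ (1 - 1 / (n : ℝ) ^ e') * P := by
  have hn1 : (1 : ℝ) ≤ n := by exact_mod_cast hn
  have hpow : (n : ℝ) ^ e ≤ (n : ℝ) ^ e' := pow_le_pow_right₀ hn1 he
  have hpos : (0 : ℝ) < (n : ℝ) ^ e := by positivity
  have h1 : 1 / (n : ℝ) ^ e' ≤ 1 / (n : ℝ) ^ e := one_div_le_one_div_of_le hpos hpow
  nlinarith

/-- **dichotomy: `MultiDevLoss3 → T`** — the special class (uni-deviation ∧ flip-stable) is discharged by the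
DEGREE-FREE law `uniDev_loss_degfree` (constant loss `1/5 ≥ 1/n`), the generic class by the residual. -/
theorem polyLossOddU3_of_multiDevLoss3 (h : MultiDevLoss3) : ExactnessDial.PolyLossOddU3 := by
  obtain ⟨C, hR⟩ := h
  refine ⟨max C 1, fun c => ?_⟩
  obtain ⟨n₁, hn₁⟩ := hR c
  refine ⟨max n₁ 16, fun n hn P hP => ?_⟩
  have hn1 : n₁ ≤ n := le_trans (le_max_left _ _) hn
  have hn16 : 16 ≤ n := le_trans (le_max_right _ _) hn
  have hP0 : (0 : ℝ) ≤ (2 : ℝ) ^ (n - 1) := by positivity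
  by_cases hc : UniDev P ∧ StabDev P
  · -- the special class: constant loss, degree-free
    have hL := uniDev_loss_degfree hn16 P hc.1 hc.2
    have hWL := Finset.card_filter_add_card_filter_not
      (s := (univ : Finset (Fin n → Bool)).filter fun x => OddZeros x)
      (fun x => Rel x (fun i => decide (P i x = 1)))
    rw [filter_filter, filter_filter] at hWL
    have hO' := HolonomyDial.card_odd_le (n := n) (by omega)
    have h5 : 5 * (univ.filter fun x : Fin n → Bool =>
        OddZeros x ∧ Rel x (fun i => decide (P i x = 1))).card ≤ 4 * 2 ^ (n - 1) := by omega
    have hfin : n * (univ.filter fun x : Fin n → Bool =>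
        OddZeros x ∧ Rel x (fun i => decide (P i x = 1))).card + 2 ^ (n - 1) ≤ n * 2 ^ (n - 1) := by
      have h1 := Nat.mul_le_mul_left n h5
      rw [Nat.mul_left_comm n 5, Nat.mul_left_comm n 4] at h1
      have h2 := Nat.mul_le_mul_right (2 ^ (n - 1)) hn16
      omega
    have hreal := real_tail n _ (2 ^ (n - 1)) (by omega) hfin
    push_cast at hreal
    exact loss_shape_mono (by omega) (le_max_right C 1) _ _ hP0 hreal
  · -- the generic class: the residual
    exact loss_shape_mono (by omega) (le_max_left C 1) _ _ hP0 (hn₁ n hn1 P hP hc)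

/-- **NODE EQUATION, typed form (rev 6, re-proved degree-free in rev 7)**: `T ⟺ MultiDevLoss3` — the target is
equivalent to its restriction to the generic class; the special class is a degree-free theorem (`uniDev_loss_degfree`). -/
theorem polyLossOddU3_iff_multiDevLoss3 : ExactnessDial.PolyLossOddU3 ↔ MultiDevLoss3 :=
  ⟨multiDevLoss3_of_polyLossOddU3, polyLossOddU3_of_multiDevLoss3⟩

/-- the two residual typings agree: `PtrLocLift3 ⟺ MultiDevLoss3`. -/
theorem ptrLocLift3_iff_multiDevLoss3 : PtrLocLift3 ↔ MultiDevLoss3 :=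
  polyLossOddU3_iff_ptrLocLift3.symm.trans polyLossOddU3_iff_multiDevLoss3

/-- **closes, generic form**: the typed residual and the outer lift give the leaf by name. -/
theorem closes_generic (hR : MultiDevLoss3) (hD : ExactnessDial.DPLift3) : AdviceFreeQNC0Three :=
  closes_T (polyLossOddU3_of_multiDevLoss3 hR) hD

/-- the generic class is NON-EMPTY at every length: the canonical guess itself (empty deviation set everywhere) is
not uni-deviation — so `MultiDevLoss3` is not vacuous. -/
theorem not_uniDev_canonical (hN : 1 ≤ N) : ¬ UniDev (N := N) (fun i => tPoly i) := by
  intro h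
  have hdev : ∀ x : Fin N → Bool, dev (fun i => tPoly i) x = ∅ := by
    intro x
    rw [dev, Finset.filter_eq_empty_iff]
    intro i _
    have : decide (tPoly i x = 1) = tGuess x i := by rw [tPoly_apply]; cases tGuess x i <;> decide
    simpa using this
  have e : (univ.filter fun x : Fin N → Bool => OddZeros x ∧ (dev (fun i => tPoly i) x).card ≠ 1) =
      univ.filter fun x : Fin N → Bool => OddZeros x := by
    apply Finset.filter_congr
    intro x _
    simp [hdev x]
  unfold UniDev at h
  rw [e] at h
  have hO := card_odd_ge (N := N) hN
  have hpos : 0 < 2 ^ (N - 1) := by positivity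
  omega

end Generic

end Summit.QuantumAdvantage.QuantumAdvantage.Theorems.AnchorDial

end
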